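import Mathlib
import Literature.AlgebraicGeometry.Resolution.AffineDomainDimension

/-!
# TropicalLinks / SchonResolves — the Laurent extension of an affine domain raises the dimension by one

Route `ResolutionOfSingularities/TropicalLinks`, crux `SchonResolves` (stmt-ResolutionOfSingularities-17234),
line `zariski-toric-closure`, stub DIM-aux1 (dimension of initial degenerations: the generic
fibre of the Gröbner family has coordinate ring `(k[M] ⧸ I)[ℤ]`, the Laurent polynomial ring over
a `d`-dimensional affine domain, and this has dimension `d + 1`).

* `schonResolves_trdeg_laurentPolynomial` — `trdeg_A A[T;T⁻¹] = 1` for a domain `A`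
  (`A[T;T⁻¹]` is a localization of `A[X]`, hence algebraic over it, and `trdeg_A A[X] = 1`).
* `schonResolves_ringKrullDim_laurent_of_finiteType` (DIM-aux1) — for a domain `A` of finite
  type over a field `k` with `dim A = d`, `dim A[ℤ] = d + 1`.

Proof: `dim = trdeg_k` for affine domains (tree
`Literature.AlgebraicGeometry.Resolution.exists_ringKrullDim_eq_and_trdeg_eq`, Matsumura Thm. 5.6),
applied to `A` and to the affine domain `A[ℤ]`, together with the tower law
`trdeg_k A[ℤ] = trdeg_k A + trdeg_A A[ℤ] = d + 1` (Mathlib `trdeg_add_eq`).  Standard material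
(Matsumura, *Commutative Ring Theory*, §5 Thm. 5.6; Kemper, *A Course in Commutative Algebra*,
Ch. 5); no new definitions.
-/

-- single-problem summit: the doubled namespace component `ResolutionOfSingularities` is forced
set_option linter.dupNamespace false

namespace Summit.ResolutionOfSingularities.ResolutionOfSingularities.Theorems

open scoped LaurentPolynomial

/-- **`trdeg_A A[T;T⁻¹] = 1`** for a domain `A`: the Laurent polynomial ring is the localization
of `A[X]` at the powers of `X`, hence algebraic over `A[X]` (`trdeg = 0`), and `trdeg_A A[X] = 1`;
conclude by the tower law for transcendence degrees. [folklore] -/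
theorem schonResolves_trdeg_laurentPolynomial (A : Type*) [CommRing A] [IsDomain A] :
    Algebra.trdeg A (AddMonoidAlgebra A ℤ) = 1 := by
  haveI : FaithfulSMul (Polynomial A) A[T;T⁻¹] :=
    (faithfulSMul_iff_algebraMap_injective _ _).mpr Polynomial.toLaurent_injective
  haveI : IsScalarTower A (Polynomial A) A[T;T⁻¹] :=
    IsScalarTower.of_algebraMap_eq fun a => by
      rw [LaurentPolynomial.algebraMap_eq_toLaurent, Polynomial.algebraMap_apply,
        Polynomial.toLaurent_C]
      rfl
  haveI : Algebra.IsAlgebraic (Polynomial A) A[T;T⁻¹] :=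
    IsLocalization.isAlgebraic _ (Submonoid.powers (Polynomial.X : Polynomial A))
  have h := trdeg_add_eq A (Polynomial A) (A := A[T;T⁻¹])
  rw [Polynomial.trdeg_of_isDomain, trdeg_eq_zero, add_zero] at h
  exact h.symm

/-- **The Laurent extension of an affine domain raises the dimension by one** (DIM-aux1): for a
domain `A` of finite type over a field `k` with `dim A = d`, the Laurent polynomial ring
`A[ℤ] = A[T;T⁻¹]` has `dim A[ℤ] = d + 1`.  (`A[ℤ]` is again an affine domain over `k`; for affine
domains `dim = trdeg_k`, and `trdeg_k A[ℤ] = trdeg_k A + trdeg_A A[ℤ] = d + 1`.)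
[cite: Matsumura1987, §5 Thm. 5.6] -/
theorem schonResolves_ringKrullDim_laurent_of_finiteType : ∀ (k : Type) [Field k] (A : Type)
    [CommRing A] [IsDomain A] [Algebra k A] [Algebra.FiniteType k A] (d : ℕ),
    ringKrullDim A = (d : WithBot ℕ∞) →
      ringKrullDim (AddMonoidAlgebra A ℤ) = ((d + 1 : ℕ) : WithBot ℕ∞) := by
  intro k _ A _ _ _ _ d hd
  -- `A[ℤ]` is an affine domain over `k`
  haveI : Algebra.FiniteType k (AddMonoidAlgebra A ℤ) :=
    Algebra.FiniteType.trans (S := A) inferInstance inferInstance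
  -- `dim = trdeg_k` for `A` and for `A[ℤ]`
  obtain ⟨m, hm, htm⟩ :=
    Literature.AlgebraicGeometry.Resolution.exists_ringKrullDim_eq_and_trdeg_eq k A
  obtain ⟨n, hn, htn⟩ :=
    Literature.AlgebraicGeometry.Resolution.exists_ringKrullDim_eq_and_trdeg_eq k
      (AddMonoidAlgebra A ℤ)
  have hmd : m = d := by
    rw [hm] at hd
    exact_mod_cast hd
  -- tower law: `trdeg_k A + trdeg_A A[ℤ] = trdeg_k A[ℤ]`, i.e. `d + 1 = n`
  have htower := trdeg_add_eq k A (A := AddMonoidAlgebra A ℤ)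
  rw [htm, hmd, schonResolves_trdeg_laurentPolynomial A, htn] at htower
  have hnd : n = d + 1 := by exact_mod_cast htower.symm
  rw [hn, hnd]

end Summit.ResolutionOfSingularities.ResolutionOfSingularities.Theorems
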